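import Summits.ResolutionOfSingularities.ResolutionOfSingularities.Theorems.HomologicalConductorNoZenoRationalAscentNormalModel
import Summits.ResolutionOfSingularities.ResolutionOfSingularities.Theorems.HomologicalConductorNoZenoRationalAscentFiniteFibre
import Summits.ResolutionOfSingularities.ResolutionOfSingularities.Theorems.HomologicalConductorNoZenoRationalAscentInfiniteFibreLocus
import Literature.AlgebraicGeometry.Morphisms.FinsetInAffineOpenOfProjective
import HarnessLib

/-!
# Crux `NoZenoR` (stmt-ResolutionOfSingularities-19943) — Lipman (1.2) 1) in ring form, PRINTED GENERALITY, MODULO statement B)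
# ONLY: every local ring of a finitely generated birational model of a rational surface germ has a rational singularity

Route `ResolutionOfSingularities/HomologicalConductor` (cell decomp-res, hand leafhand-res-homologicalconduct-12 g1).
OURS: AI-written, weaker than expert review; nothing here is a statement of the manuscript under review (Hironaka 2017).
SUPPORT level (`--supports stmt-19943`), counted 0.  Def-free.  Named fact consumed: ONLY the hypothesis
`(hB : Lipman1969_1_2_B)` (statement B) of Lipman's proof of (1.2) = a special case of Zariski's Theorem (26.1)).

`hasRationalSingularity_of_isLocalization_of_B_global` — **Lipman's Proposition (1.2) 1) in ring form, with NO extra binder**: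
`R` a two-dimensional normal Noetherian local domain with a rational singularity, `B ⊇ R` ANY finitely generated `R`-algebra and
domain with a common denominator (a birational affine model `Spec B → Spec R`), `𝔮` ANY prime: `T = B_𝔮` has a rational
singularity in the sense of Definition (1.1) (a desingularization with `H¹ = 0`).  This is Lipman's proof (p. 200 with footnote
(1)) in full: projective model `W* ⊇ Spec B` (`exists_projectiveModel_of_isAffine`); B) ⇒ `h : Z → W*` with `H¹(Z, 𝒪_Z) = 0`
((1.2) 2) mod B)); «`R¹h_*𝒪_Z` has support of dimension `≤ 0`» = the infinite-fibre locus `S` of `h` is a finite set of closed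
points (`finite_setOf_infinite_preimage`, `isClosed_singleton_of_infinite_preimage`) and `R¹h_*𝒪_Z = 0` off `S`
(`hasTrivialCechH1_pullback_snd_fromSpecStalk_of_finite_preimage`, Zariski's Main Theorem); EGA III (4.2.2) = the PROVED
projective Görtz–Wedhorn 24.44 (p613816) inside the core `hasRationalSingularity_of_chart_of_forall_stalk`, applied to the «good
cover» by an affine open `W₀ ⊇ S ∪ {𝔮}` (finitely many points of a projective scheme lie in an affine open,
`exists_isAffineOpen_forall_mem_of_isAffineHom_toProj`) and affine opens avoiding `S`.

Consequence: `NoZeno.SandwichCluster.hasRationalSingularity_of_isLocalization (h12 : Lipman1969_1_2)` is replaceable by this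
theorem with `hB : Lipman1969_1_2_B` and NO further binder (its hypotheses `IsIntegrallyClosed T`, `ringKrullDim T = 2` become
unnecessary); hence `hasRationalSingularity_tower_of_B` needs no `EssFiniteType k R` either (re-threading left to the planner).
No crux, kill test or summit statement is proved; resolution of singularities in positive characteristic is NOT proved.

## References
* J. Lipman, *Rational singularities …*, Publ. Math. IHÉS 36 (1969): Prop. (1.2) 1) and its proof, p. 200 with footnote (1);
  statement B) (p. 200). [Lipman1969]
* The Stacks Project, Tag 02UP. [StacksProject]
-/

-- single-problem summit: the doubled namespace component `ResolutionOfSingularities` is forced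
set_option linter.dupNamespace false

noncomputable section

namespace Summit.ResolutionOfSingularities.ResolutionOfSingularities.Theorems.NoZeno.RationalAscent

open CategoryTheory CategoryTheory.Limits AlgebraicGeometry TopologicalSpace IsLocalRing
open Literature.AlgebraicGeometry.Resolution Literature.AlgebraicGeometry.Morphisms
open Summit.ResolutionOfSingularities.ResolutionOfSingularities.Theorems.SurfaceTermination.GenusDescent
open Summit.ResolutionOfSingularities.ResolutionOfSingularities.Theorems.NoZeno.SandwichCluster

/-- **Lipman 1969, Proposition (1.2) 1) in ring form, MODULO statement B) only.**  `R` a two-dimensional normal Noetherian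
local domain with a rational singularity; `B ⊇ R` a finitely generated `R`-algebra and a domain with a common denominator
`r ≠ 0`; `𝔮` a prime ideal of `B`.  Then `T = B_𝔮` has a rational singularity.
[cite: Lipman1969, Proposition (1.2) 1), proof p. 200 with footnote (1); statement B) (p. 200)] [cite: StacksProject, Tag 02UP] -/
theorem hasRationalSingularity_of_isLocalization_of_B_global (hB : Lipman1969_1_2_B.{0}) {R B T : Type}
    [CommRing R] [IsNoetherianRing R] [IsLocalRing R] [IsDomain R] [IsIntegrallyClosed R]
    (hdimR : ringKrullDim R = 2) (hratR : HasRationalSingularity R)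
    [CommRing B] [IsDomain B] [Algebra R B] [Algebra.FiniteType R B]
    (hinj : Function.Injective (algebraMap R B)) (r : R) (hr : r ≠ 0)
    (hden : ∀ b : B, ∃ n : ℕ, ∃ a : R, algebraMap R B a = algebraMap R B r ^ n * b)
    (𝔮 : Ideal B) [𝔮.IsPrime] [CommRing T] [Algebra B T] [IsLocalization.AtPrime T 𝔮] :
    HasRationalSingularity T := by
  classical
  haveI : IsNoetherianRing B := Algebra.FiniteType.isNoetherianRing R B
  haveI : IsDomain (CommRingCat.of B) := ‹IsDomain B›
  haveI : IsNoetherianRing (CommRingCat.of R) := ‹IsNoetherianRing R›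
  haveI : IsLocalRing (CommRingCat.of R) := ‹IsLocalRing R›
  haveI : IsDomain (CommRingCat.of R) := ‹IsDomain R›
  haveI : IsDomain T := IsLocalization.isDomain_of_le_nonZeroDivisors T (Ideal.primeCompl_le_nonZeroDivisors 𝔮)
  -- the birational affine model and its projective model
  let g : Spec (.of B) ⟶ Spec (.of R) := Spec.map (CommRingCat.ofHom (algebraMap R B))
  haveI : LocallyOfFiniteType g := by
    rw [HasRingHomProperty.Spec_iff (P := @LocallyOfFiniteType)]
    exact RingHom.finiteType_algebraMap.mpr ‹Algebra.FiniteType R B›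
  have hbir : IsBirational g := isBirational_specMap_of_denominator hinj r hr hden
  obtain ⟨W, hWint, j, hj, gW, hgW, hjg, hproj, hbirW⟩ := exists_projectiveModel_of_isAffine g hbir
  haveI := hWint
  haveI := hj
  haveI := hgW
  haveI : W.IsSeparated := ⟨by rw [← terminal.comp_from gW]; infer_instance⟩
  haveI : IsLocallyNoetherian W := LocallyOfFiniteType.isLocallyNoetherian gW
  haveI : CompactSpace W := QuasiCompact.compactSpace_of_compactSpace gW
  haveI : IsNoetherian W := {}
  -- statement B) on a desingularization of the rational `R`: `h : Z → W` with `H¹(Z, 𝒪_Z) = 0`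
  obtain ⟨X, fX, hfX, -⟩ := id hratR
  obtain ⟨Z, jZ, h, hjZ, hfac⟩ := hB R hdimR X fX hfX W gW hbirW
  haveI : IsProper jZ := hjZ.isProper
  haveI : IsProper fX := hfX.isProper
  have hres : IsResolution (jZ ≫ fX) := ⟨inferInstance, hjZ.isBirational.comp hfX.isBirational, hjZ.isRegular⟩
  have hZ0 : HasTrivialCechH1 (jZ ≫ fX) :=
    Lipman1969_1_2_B.hasTrivialCechH1_of_isResolution hB hdimR hratR _ hres
  have hZ : HasTrivialCechH1 (h ≫ gW) := by rw [hfac]; exact hZ0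
  haveI : IsProper (h ≫ gW) := by rw [hfac]; infer_instance
  haveI : IsProper h := IsProper.of_comp h gW
  haveI : IsIntegral Z := hres.isIntegral_source
  haveI : IsLocallyNoetherian Z := LocallyOfFiniteType.isLocallyNoetherian (h ≫ gW)
  haveI : CompactSpace Z := QuasiCompact.compactSpace_of_compactSpace (h ≫ gW)
  haveI : IsNoetherian Z := {}
  have hbirh : IsBirational h := isBirational_of_comp' hbirW (by rw [hfac]; exact hres.isBirational)
  have hZreg : Scheme.IsRegular Z := hjZ.isRegular
  have hdimSpecR : topologicalKrullDim (Spec (.of R)) ≤ 2 := by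
    change topologicalKrullDim (PrimeSpectrum R) ≤ 2
    rw [PrimeSpectrum.topologicalKrullDim_eq_ringKrullDim]
    exact hdimR.le
  have hdimZ : topologicalKrullDim Z ≤ 2 := by
    rw [← hfac] at hres
    exact hres.isBirational.topologicalKrullDim_le_of_isNoetherian.trans hdimSpecR
  -- the point `w = 𝔮` and `𝒪_{W,w} ≅ 𝒪_{Spec B,𝔮} ≅ T`
  let y : Spec (.of B) := ⟨𝔮, ‹𝔮.IsPrime›⟩
  letI : Algebra B ((Spec (.of B)).presheaf.stalk y) := StructureSheaf.stalkAlgebra B y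
  haveI : IsLocalization.AtPrime ((Spec (.of B)).presheaf.stalk y) 𝔮 :=
    StructureSheaf.IsLocalization.to_stalk B y
  let e₂ : (Spec (.of B)).presheaf.stalk y ≃ₐ[B] T := IsLocalization.algEquiv 𝔮.primeCompl _ _
  let e₁ : W.presheaf.stalk (j y) ≅ (Spec (.of B)).presheaf.stalk y := asIso (j.stalkMap y)
  let e : W.presheaf.stalk (j y) ≃+* T := e₁.commRingCatIsoToRingEquiv.trans e₂.toRingEquiv
  -- «`R¹h_*𝒪_Z` has support of dimension `≤ 0`»: the infinite-fibre locus `S` is a finite set of closed points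
  set S : Set W := {x : W | (h ⁻¹' {x}).Infinite} with hSdef
  have hSfin : S.Finite := finite_setOf_infinite_preimage h hbirh hdimZ
  have hSc : ∀ x ∈ S, IsClosed ({x} : Set W) := fun x hx => isClosed_singleton_of_infinite_preimage h hbirh hdimZ hx
  -- an affine open `W₀ ⊇ S ∪ {w}` of the projective `W`
  obtain ⟨n, ι, hι⟩ := id hproj
  letI : GradedRing (MvPolynomial.homogeneousSubmodule (Fin (n + 1)) R) := MvPolynomial.gradedAlgebra
  let q : W ⟶ Proj (MvPolynomial.homogeneousSubmodule (Fin (n + 1)) R) := ι.left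
  haveI : IsClosedImmersion q := hι
  haveI hqaff : IsAffineHom q := inferInstance
  obtain ⟨W₀, hW₀, hmem⟩ := exists_isAffineOpen_forall_mem_of_isAffineHom_toProj
    (MvPolynomial.homogeneousSubmodule (Fin (n + 1)) R) q (insert (j y) hSfin.toFinset)
  have hwW₀ : j y ∈ W₀ := hmem _ (Finset.mem_insert_self _ _)
  have hSW₀ : S ⊆ (W₀ : Set W) := fun x hx =>
    hmem x (Finset.mem_insert_of_mem (hSfin.mem_toFinset.mpr hx))
  -- the good cover `{W₀} ∪ {W_b ⊆ W ∖ S}`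
  obtain ⟨α, _, a₀, Wc, hWa₀, hWaff, hWcov, hdisj⟩ := exists_affineCover_eq_and_disjoint W₀ hW₀ S hSfin hSc hSW₀
  subst hWa₀
  have hW₀' : IsAffineOpen (Wc a₀) := hWaff a₀
  -- off `S` the fibres are finite, so `R¹h_*𝒪_Z = 0` there (Zariski's Main Theorem)
  have hpt : ∀ b, b ≠ a₀ → ∀ x ∈ Wc a₀ ⊓ Wc b, HasTrivialCechH1 (pullback.snd h (W.fromSpecStalk x)) := by
    intro b hb x hx
    have hxS : x ∉ S := fun hxS => Set.disjoint_left.mp (hdisj b hb) hxS hx.2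
    have hfin : (h ⁻¹' {x}).Finite := Set.not_infinite.mp hxS
    exact hasTrivialCechH1_pullback_snd_fromSpecStalk_of_finite_preimage h x hfin
  -- the chart `σ : h⁻¹W₀ → W₀ ≅ Spec Γ(W, W₀)` and its structure map over `R`
  let N : Type := Γ(W, Wc a₀)
  haveI : Nonempty ↥(Wc a₀) := ⟨⟨j y, hwW₀⟩⟩
  let φ : CommRingCat.of R ⟶ Γ(W, Wc a₀) := Spec.preimage (hW₀'.fromSpec ≫ gW)
  letI : Algebra R N := φ.hom.toAlgebra
  let σ : ((h ⁻¹ᵁ Wc a₀ : Z.Opens) : Scheme.{0}) ⟶ Spec (.of N) := (h ∣_ Wc a₀) ≫ hW₀'.isoSpec.hom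
  have hσ : IsResolution σ := by
    have h1 : IsResolution (h ∣_ Wc a₀) := IsResolution.morphismRestrict ⟨inferInstance, hbirh, hZreg⟩ (Wc a₀)
    haveI := h1.isProper
    exact ⟨inferInstance, h1.isBirational.comp_iso _, h1.isRegular⟩
  have hσT : (h ⁻¹ᵁ Wc a₀).ι ≫ (h ≫ gW) = σ ≫ Spec.map (CommRingCat.ofHom (algebraMap R N)) := by
    have h1 : Spec.map (CommRingCat.ofHom (algebraMap R N)) = hW₀'.fromSpec ≫ gW := by
      change Spec.map φ = _
      exact Spec.map_preimage _
    rw [h1, ← hW₀'.isoSpec_inv_ι]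
    simp only [σ, Category.assoc, Iso.hom_inv_id_assoc]
    rw [← Category.assoc (h ∣_ Wc a₀), morphismRestrict_ι, Category.assoc]
  -- the local ring at `w` is a localisation of the chart ring
  haveI : Nonempty ↥((Wc a₀ : W.Opens) : Scheme.{0}) := ⟨(⟨j y, hwW₀⟩ : Wc a₀)⟩
  haveI : IsDomain N := IsIntegral.component_integral (Wc a₀)
  letI : Algebra N (W.presheaf.stalk (j y)) := W.presheaf.algebra_section_stalk (⟨j y, hwW₀⟩ : Wc a₀)
  haveI : IsLocalization.AtPrime (W.presheaf.stalk (j y)) (hW₀'.primeIdealOf ⟨j y, hwW₀⟩).asIdeal :=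
    hW₀'.isLocalization_stalk ⟨j y, hwW₀⟩
  have hrat : HasRationalSingularity (W.presheaf.stalk (j y)) :=
    hasRationalSingularity_of_chart_of_forall_stalk hdimR.le gW hbirW hproj h hZ Wc hWaff hWcov a₀ hpt
      σ hσ hσT (W.presheaf.stalk (j y)) (hW₀'.primeIdealOf ⟨j y, hwW₀⟩).asIdeal.primeCompl
  exact HasRationalSingularity.of_ringEquiv e hrat

end Summit.ResolutionOfSingularities.ResolutionOfSingularities.Theorems.NoZeno.RationalAscent

end
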